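import Summits.BirchSwinnertonDyer.BirchSwinnertonDyer.Theorems.ErratumRoadFiveRamNoErratumDataKolyvagin
import Summits.BirchSwinnertonDyer.BirchSwinnertonDyer.Theorems.ErratumRoadFiveKolyvaginFramesTight
import Summits.BirchSwinnertonDyer.Rank1Residual.X11b.BDPRouteEndState
import HarnessLib

/-!
# Route `ErratumRoadFive` (rung K2a): crux `RamNoErratumDataAtFive` (item stmt-BirchSwinnertonDyer-19624, REST‴) is
# EQUIVALENT to {Kolyvagin hypothesis `hZα` on (α) ∩ Locus} ∧ {its Tamagawa part REST⁗}, modulo the published inputs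
# (cell `bsd-stepL`, seat `bsd-stepL-imc-p1` g5; `--supports stmt-BirchSwinnertonDyer-19624`)

THEOREMS ONLY (no definition, no named fact, no `sorry`); nothing here proves the crux; BSD is proved for no pair; every
published ∕ cited named fact is a HYPOTHESIS (the route's support conjunction `PublishedInputsFive` 19066 and by-name leaf
`JSWAnticyclotomicControlMult` 19626; Shimura reciprocity at conductor 1, Gross 1991 §3 ×2, Darmon Thm. 3.6 and BOTH halves of
McCallum 1991 Cor. 5.6 as Literature named facts — the conjuncts of the KOLY route's `PublishedInputsKolyThree`). PARTITION:
X11b@p≥5 (B9 ∕ N8) × crux 19624 (cw 703 204 = Kolyvagin part 680 724 + REST⁗ 22 480) — types-the-object-of; closes: none.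

THE POINT (for the planner's split of 19624, BC-style «each child weaker than the parent, children ⟹ parent»): with
`ramNoErratumDataAtFive_of_kolyvaginFramesHLAlpha_of_restTam` (children ⟹ parent, p446274) this file supplies the two
converse arrows — `RamNoErratumDataAtFive ⟹ REST⁗` (drop rows; `restTam_of_ramNoErratumDataAtFive`, p446274) and
`RamNoErratumDataAtFive ⟹ hZα` modulo the published inputs: at an (α) ∩ Locus pair the crux gives the open input (the pair
carries no erratum datum — (iv) is automatic on `p ∤ ∏ c_ℓ`), the route's end state `P2.bsdp_of_locus_endState` (multr1-p2
gen 18: published facts + open input ⟹ `BSD(E,p)` on the Locus) gives `BSDp W p`, and tightness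
(`Koly.kolyvaginClass_one_ne_zero_of_bsdp_of_hlFrame_of_five_le`, p446724) gives the non-zero class at every Hoffstein–Luo
frame. Hence `RamNoErratumDataAtFive ⟺ hZα ∧ REST⁗` modulo PUB: the split is an honest EQUIVALENCE, and the Kolyvagin child
is exactly as strong as the crux on its own pairs.

* `kolyvaginFramesHLAlpha_of_ramNoErratumDataAtFive` — the crux ⟹ `hZα`, modulo PUB;
* `ramNoErratumDataAtFive_iff_kolyvaginFramesHLAlpha_and_restTam` — the equivalence, modulo PUB.

References (locators only): [cite: WZhang2014, Remark 5 and Thm. 10.2] [cite: McCallumLMS1991, §5 Cor. 5.6 (both halves)]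
[cite: GrossLMS1991, §3 and §4 (4.1)] [cite: Darmon2004, Thm. 3.6] [cite: JetchevSkinnerWan2017, Thm. 3.3.1, §7.4.1–7.4.3]
[cite: Castella2018Erratum, Thm. 1.1 (iii)–(iv)] [cite: SkinnerZhang2014, Thm. 1.3 (shape of `hZα`)].
-/

noncomputable section

open scoped Classical

set_option linter.dupNamespace false

namespace Summit.BirchSwinnertonDyer.BirchSwinnertonDyer.Theorems

open WeierstrassCurve NumberField IsDedekindDomain Literature.NumberTheory.EllipticCurves
  Literature.NumberTheory.EllipticCurves.ModularForms
  Literature.NumberTheory.EllipticCurves.Rank1Residual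
  Literature.NumberTheory.GaloisCohomology Literature.NumberTheory.GaloisRepresentations
  Summit.BirchSwinnertonDyer.Rank1Residual Summit.BirchSwinnertonDyer.Rank1Residual.X11b
  Summit.BirchSwinnertonDyer.BirchSwinnertonDyer.Theses.ErratumRoadFive

/-- **The crux `RamNoErratumDataAtFive` IMPLIES the Kolyvagin hypothesis `hZα`, modulo the published inputs.** Granted
`PublishedInputsFive` (Gross–Zagier, Kolyvagin ×2, Skinner 2016 Thm C, Wuthrich, GZK, modularity, newforms, Hoffstein–Luo, Mazur,
Poitou–Tate, local Euler–Poincaré are used), Shimura reciprocity at conductor 1 (`hrec`), Gross 1991 §3 (`h1`, `h2`) and McCallum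
Cor. 5.6's divisibility half (`hMcU`): if the crux holds, then at every (α) ∩ Locus pair (`(E,p) ∈ X11b`, `p ≥ 5`, (ram),
`p ∤ ∏ c_ℓ`, no odd non-split `E[p]`-ramified witness) every Manin-good conductor-1 frame of every Hoffstein–Luo field carries a
non-zero mod-`p` Kolyvagin class. Chain: crux ⟹ open input at the pair (no erratum datum there) ⟹ `BSDp W p`
(`P2.bsdp_of_locus_endState`) ⟹ non-zero class (`Koly.kolyvaginClass_one_ne_zero_of_bsdp_of_hlFrame_of_five_le`). CONDITIONAL on
every binder; nothing booked. [cite: WZhang2014, Remark 5 and Thm. 10.2] [cite: McCallumLMS1991, §5 Lemma 5.1 and Cor. 5.6]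
[cite: JetchevSkinnerWan2017, §7.4.1–7.4.3 (pp. 30–31)] -/
theorem kolyvaginFramesHLAlpha_of_ramNoErratumDataAtFive
    (hF : PublishedInputsFive)
    (hrec : ∀ (N : ℕ) [NeZero N] (W : WeierstrassCurve ℚ) (K : Type) [Field K] [NumberField K],
      heegnerPointOfConductor_one_galoisConj N W K)
    (h1 : ∀ (N : ℕ) [NeZero N] (W : WeierstrassCurve ℚ) (K : Type) [Field K] [NumberField K],
      phi_heegnerPointOfConductor_mem_range_map_ringClassField N W K)
    (h2 : ∀ (K : Type) [Field K] [NumberField K], exists_generator_ringClassGalOver K)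
    (hMcU : McCallum1991_padicValNat_card_sha_primary_add_le_of_globalDivisibility)
    (h : RamNoErratumDataAtFive) :
    ∀ (W : WeierstrassCurve ℚ) [W.IsElliptic] [W.IsGloballyMinimal] [NeZero (W.conductorNorm ℤ)]
      (p : ℕ) [hp : Fact p.Prime] (K : Type) [Field K] [NumberField K]
      (Dt : ModularParametrizationData W (W.conductorNorm ℤ)) (β : ℤ) (ι : K →+* ℂ),
      ClassX11b W p → 5 ≤ p → W.HasMultiplicativeReductionAtPrime p → Rank1Residual.Surj W p →
      Rank1Residual.Ram W p → ¬ p ∣ W.tamagawaProduct →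
      (∀ (q : ℕ) [Fact q.Prime], q ≠ 2 → q ≠ p → Rank1Residual.Mult W q →
        ¬ W.HasSplitMultiplicativeReductionAtPrime q → p ∣ padicValInt q W.minimalDiscriminantInt) →
      IsImaginaryQuadratic K → Odd (NumberField.discr K) →
      SatisfiesHeegnerHypothesis (W.conductorNorm ℤ) K →
      (W.quadraticTwist (NumberField.discr K : ℚ)).entireLFunction 1 ≠ 0 →
      NumberField.discr K ≠ -3 →
      (4 * (W.conductorNorm ℤ : ℤ)) ∣ β ^ 2 - NumberField.discr K → ¬ (p : ℤ) ∣ Dt.c →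
      ∃ (n : ℕ) (d : KolyvaginHeegnerData Dt β ι n),
        KolyvaginDescent.KolSupp (Zhang2014.IsKolyvaginPrime (W.conductorNorm ℤ) W K p) n ∧
          d.kolyvaginClass hp.out 1 ≠ 0 := by
  obtain ⟨hGZ, hKo, hB, hSk, hWu, hGZK, hmod, hnf, hHL, -, hMaz, -, -, hPT, hEP⟩ := hF
  intro W _ _ _ p hp K _ _ Dt β ι hX hp5 _ _ hram htam hα hK hodd hH hLt h3 hβ hc
  -- the pair carries no erratum datum: no odd non-split E[p]-ramified witness
  have hno : ¬ ((∃ (q : ℕ) (_ : Fact q.Prime), q ≠ 2 ∧ q ≠ p ∧ Rank1Residual.Mult W q ∧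
        ¬ W.HasSplitMultiplicativeReductionAtPrime q ∧ ¬ p ∣ padicValInt q W.minimalDiscriminantInt) ∧
      (∀ P : (W.baseChange ℚ_[p]).toAffine.Point, p • P = 0 → P = 0)) := by
    rintro ⟨⟨q, hq, hq2, hqp, hmq, hnsq, hv⟩, -⟩
    exact hv (@hα q hq hq2 hqp hmq hnsq)
  -- the crux gives the open input at this pair; the end state gives BSD(E,p)
  have hopen : P2OpenInputOnTreeAt W p := h W p hram hno
  have hbsd : BSDp W p :=
    P2.bsdp_of_locus_endState W p hGZ hKo hB hSk hWu hGZK hmod hnf hHL hMaz hPT hEP hopen hX hp5 hram htam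
  -- tightness: BSD(E,p) forces a non-zero class at this Hoffstein–Luo frame
  exact Three.Koly.kolyvaginClass_one_ne_zero_of_bsdp_of_hlFrame_of_five_le W K Dt β ι p (hGZ _ W K) (hKo _ W K)
    hSk hGZK hmod (hrec _ W K) (h1 _ W K) (h2 K) hMcU hX hp5 hram htam hK hodd hH hLt h3 hβ hc hbsd

/-- **`RamNoErratumDataAtFive ⟺ hZα ∧ REST⁗`, modulo the published inputs** — the honest equivalence behind the split of crux
19624 into its Kolyvagin part (conjecture-tagged, TIGHT) and its Tamagawa part REST⁗ (no road). Binders: `PublishedInputsFive`,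
`JSWAnticyclotomicControlMult`, Shimura reciprocity at conductor 1, Gross 1991 §3 ×2, Darmon Thm. 3.6, both halves of McCallum
Cor. 5.6. (⟹) `kolyvaginFramesHLAlpha_of_ramNoErratumDataAtFive` and `restTam_of_ramNoErratumDataAtFive`; (⟸)
`ramNoErratumDataAtFive_of_kolyvaginFramesHLAlpha_of_restTam`. CONDITIONAL on every binder; nothing booked.
[cite: WZhang2014, Thm. 1.1, Remark 5 and Thm. 10.2] [cite: McCallumLMS1991, §5 Cor. 5.6 (both halves)] [cite: Darmon2004, Thm. 3.6]
[cite: JetchevSkinnerWan2017, Thm. 3.3.1] -/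
theorem ramNoErratumDataAtFive_iff_kolyvaginFramesHLAlpha_and_restTam
    (hF : PublishedInputsFive) (h331 : JSWAnticyclotomicControlMult)
    (hrec : ∀ (N : ℕ) [NeZero N] (W : WeierstrassCurve ℚ) (K : Type) [Field K] [NumberField K],
      heegnerPointOfConductor_one_galoisConj N W K)
    (h1 : ∀ (N : ℕ) [NeZero N] (W : WeierstrassCurve ℚ) (K : Type) [Field K] [NumberField K],
      phi_heegnerPointOfConductor_mem_range_map_ringClassField N W K)
    (h2 : ∀ (K : Type) [Field K] [NumberField K], exists_generator_ringClassGalOver K)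
    (h36 : ∀ (N : ℕ) [NeZero N] (W : WeierstrassCurve ℚ) (K : Type) [Field K] [NumberField K],
      phi_heegnerTau_mem_range_map_singularModuliField N W K)
    (hMc : McCallum1991_pow_dvd_card_sha_primary_of_certificate)
    (hMcU : McCallum1991_padicValNat_card_sha_primary_add_le_of_globalDivisibility) :
    RamNoErratumDataAtFive ↔
      ((∀ (W : WeierstrassCurve ℚ) [W.IsElliptic] [W.IsGloballyMinimal] [NeZero (W.conductorNorm ℤ)]
          (p : ℕ) [hp : Fact p.Prime] (K : Type) [Field K] [NumberField K]
          (Dt : ModularParametrizationData W (W.conductorNorm ℤ)) (β : ℤ) (ι : K →+* ℂ),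
          ClassX11b W p → 5 ≤ p → W.HasMultiplicativeReductionAtPrime p → Rank1Residual.Surj W p →
          Rank1Residual.Ram W p → ¬ p ∣ W.tamagawaProduct →
          (∀ (q : ℕ) [Fact q.Prime], q ≠ 2 → q ≠ p → Rank1Residual.Mult W q →
            ¬ W.HasSplitMultiplicativeReductionAtPrime q → p ∣ padicValInt q W.minimalDiscriminantInt) →
          IsImaginaryQuadratic K → Odd (NumberField.discr K) →
          SatisfiesHeegnerHypothesis (W.conductorNorm ℤ) K →
          (W.quadraticTwist (NumberField.discr K : ℚ)).entireLFunction 1 ≠ 0 →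
          NumberField.discr K ≠ -3 →
          (4 * (W.conductorNorm ℤ : ℤ)) ∣ β ^ 2 - NumberField.discr K → ¬ (p : ℤ) ∣ Dt.c →
          ∃ (n : ℕ) (d : KolyvaginHeegnerData Dt β ι n),
            KolyvaginDescent.KolSupp (Zhang2014.IsKolyvaginPrime (W.conductorNorm ℤ) W K p) n ∧
              d.kolyvaginClass hp.out 1 ≠ 0) ∧
        (∀ (W : WeierstrassCurve ℚ) [W.IsElliptic] [W.IsGloballyMinimal] (p : ℕ) [Fact p.Prime],
          Rank1Residual.Ram W p →
          ¬ ((∃ (q : ℕ) (_ : Fact q.Prime), q ≠ 2 ∧ q ≠ p ∧ Rank1Residual.Mult W q ∧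
                ¬ W.HasSplitMultiplicativeReductionAtPrime q ∧ ¬ p ∣ padicValInt q W.minimalDiscriminantInt) ∧
              (∀ P : (W.baseChange ℚ_[p]).toAffine.Point, p • P = 0 → P = 0)) →
          p ∣ W.tamagawaProduct → P2OpenInputOnTreeAt W p)) :=
  ⟨fun h ↦ ⟨kolyvaginFramesHLAlpha_of_ramNoErratumDataAtFive hF hrec h1 h2 hMcU h,
      restTam_of_ramNoErratumDataAtFive h⟩,
    fun h ↦ ramNoErratumDataAtFive_of_kolyvaginFramesHLAlpha_of_restTam hF h331 hrec hMc h36 h.1 h.2⟩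

end Summit.BirchSwinnertonDyer.BirchSwinnertonDyer.Theorems

end
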